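import Mathlib
import Summits.HodgeConjecture.FermatCycles.HodgeFermatTheoremZ3UA

/-!
# THEOREM Z3U — the pattern (Z3, U) at the prime 3, from THEOREM KR6 — part 2: `z3u_of_kr6` (`HodgeFermat/TheoremZ3U.lean`; HF-G29)

Tree copy (part 2 of 2) of the module `HodgeFermat/TheoremZ3U.lean` of the sibling cell's standalone package
`run/shared/lean/pub/pub-hodgefermat/lean/HodgeFermat/` (465 lines, sha256 `218d15e3579ca1b3…`), source lines 289–465 (§§5–8 the stabiliser, no fixed point, the 7-cycle, `z3uShape_of_kr6`, `z3u_of_kr6`).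
Filed by cell `pub-hfermat`, seat prover-1 gen-3, on the COORDINATOR KEEPER RULING of 2026-08-25 (gem sweep H1: take the
off-gate kernel theorem `thmFstar` through the gate) — here THEOREM F* of `tables/DPRIME-THEOREM.md` §9 IN FULL, i.e.
PROPOSITION D′(3N) and the descent (`HodgeFermat/PropDPrimeNFinal.lean`, GATE HF-G34), the last off-gate form of THEOREM F*
(its first two forms, `DecodingFinal.thmFstar` = F* at the prime levels and `ThmFstarNFinal.thmFstar` = F*(3N), landed on
2026-08-25 as `HodgeFermatThmFstar.lean` / `HodgeFermatThmFstarN.lean`, seats prover-1 gen-0 / gen-2); this file is one link of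
the import closure of `PropDPrimeNFinal.propDprime` (the sibling's KR-free chain: THEOREM L, COROLLARY M, THEOREM D6,
THEOREM U⁺, THEOREM KR6, THEOREM Z3U) on top of those landed chains.  The source module is the sibling's hub-checked module of
record (pub-hodgefermat `CERT.md` l.933, GATE HF-G29); its declarations are copied VERBATIM.
Deviations from the source module, exhaustively: the `import` lines (tree modules `Summits.HodgeConjecture.FermatCycles.
HodgeFermat*` instead of `HodgeFermat.*`); this module docstring; the `set_option`/namespace/`open` preamble (source l.53–58) and part 1's two re-binding `open` lines are repeated at the top because the module is split. The module docstring is quoted in full in part 1.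
Every other line — in particular every declaration's statement and proof — is byte-identical to the source.
HONEST FRAMING: explicit algebraic cycles for specific Hodge classes on Fermat/Delsarte varieties; residual open instances
listed; no claim on general Hodge.  (This file is arithmetic of CM types / finite combinatorics / analytic number theory
of the sibling's KR-free programme; it claims nothing about cycles.)
-/

set_option autoImplicit false

namespace HodgeFermat.KRFree.TheoremZ3U

open Finset HodgeFermat.KRFree.LemmaN HodgeFermat.KRFree.LemmaO HodgeFermat.KRFree.TheoremL
open HodgeFermat.KRFree.TheoremUEq (Perm3 rsum_rot)

open HodgeFermat.KRFree.Bridge renaming res_pos → res_pos'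
open HodgeFermat.KRFree.Decoding (unit_mul_not_dvd)

/-! ## (3) `w = −3̄` stabilises the CM type of `T̄′` -/

/-- `H_{wT̄′} = H_{T̄′}` on `(ℤ/n)ˣ` for `w = 3(n − 1) ≡ −3`: the `3̄⁻¹`-twist composed with the negation symmetry -/
lemma stab {n a b c x y z : ℕ} (h3n : ¬ 3 ∣ n) (hn : 0 < n) (hs' : 3 * n ∣ x + y + z)
    (hx : ¬ 3 ∣ x) (hy : ¬ 3 ∣ y) (hz : ¬ 3 ∣ z) (hH : SameType (3 * n) (3 * a, 3 * b, 3 * c) (x, y, z)) :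
    SameType n (x, y, z) (3 * (n - 1) * x, 3 * (n - 1) * y, 3 * (n - 1) * z) := by
  obtain ⟨hxn, hyn, hzn⟩ := no_zero h3n hn hs' hx hy hz hH
  have hs1 : n ∣ x + y + z := dvd_of_level hs'
  have h3u : Nat.Coprime 3 n := (Nat.Prime.coprime_iff_not_dvd Nat.prime_three).mpr h3n
  intro s hs
  have hns : Nat.Coprime ((n - 1) * s) n := coprime_neg' hn hs
  have ht₀ : Nat.Coprime (3 * ((n - 1) * s)) n := Nat.Coprime.mul_left h3u hns
  have ht₁ : 3 * ((n - 1) * s) ≡ 3 * ((n - 1) * s) [MOD n] := Nat.ModEq.refl _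
  -- the twist: (n−1)s ∈ H ⟺ 3(n−1)s ∉ H
  have h2 := (core h3n hn hs' hx hy hz hH ht₀ ht₁).2
  -- the negation symmetry: (n−1)s ∈ H ⟺ s ∉ H
  have hneg : InH n (x, y, z) ((n - 1) * s) ↔ ¬ InH n (x, y, z) s := by
    have e := rsum_neg' hn (unit_mul_not_dvd hs hxn) (unit_mul_not_dvd hs hyn) (unit_mul_not_dvd hs hzn)
    obtain ⟨hR, hI⟩ := rsum_cases hn hs1 (unit_mul_not_dvd hs hzn)
    obtain ⟨hR', hI'⟩ := rsum_cases hn hs1 (unit_mul_not_dvd hns hzn)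
    rw [hI, hI']
    omega
  have h3 : InH n (x, y, z) (3 * ((n - 1) * s)) ↔ InH n (x, y, z) s := not_iff_not.mp (h2.symm.trans hneg)
  rw [← h3]
  show 3 * ((n - 1) * s) * x % n + 3 * ((n - 1) * s) * y % n < n ↔
    s * (3 * (n - 1) * x) % n + s * (3 * (n - 1) * y) % n < n
  rw [show s * (3 * (n - 1) * x) = 3 * ((n - 1) * s) * x by ring,
    show s * (3 * (n - 1) * y) = 3 * ((n - 1) * s) * y by ring]

/-! ## (4) The unit `w = −3̄` permuting `T̄′`: no fixed entry, a 3-cycle forces `7x ≡ 0` -/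

/-- `x ≡ wx (mod n)` with `w ≡ −3` is impossible for `n` odd and `x ≢ 0`: it says `4x ≡ 0` -/
lemma no_fix {n x : ℕ} (hn : 0 < n) (h2 : ¬ 2 ∣ n) (hxn : ¬ n ∣ x) : x % n ≠ 3 * (n - 1) * x % n := by
  intro h
  obtain ⟨m, rfl⟩ : ∃ m, n = m + 1 := ⟨n - 1, by omega⟩
  rw [Nat.add_sub_cancel] at h
  have h1 : x + 3 * x ≡ 3 * m * x + 3 * x [MOD m + 1] := Nat.ModEq.add_right _ h
  have h0 : 3 * m * x + 3 * x ≡ 0 [MOD m + 1] := Nat.modEq_zero_iff_dvd.mpr ⟨3 * x, by ring⟩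
  have h4 : (m + 1) ∣ 4 * x := by
    have h5 := Nat.modEq_zero_iff_dvd.mp (h1.trans h0)
    rwa [show x + 3 * x = 4 * x by ring] at h5
  have hco : Nat.Coprime (m + 1) 4 := by
    have h2c : Nat.Coprime (m + 1) 2 := ((Nat.Prime.coprime_iff_not_dvd Nat.prime_two).mpr h2).symm
    rw [show (4 : ℕ) = 2 ^ 2 by norm_num]
    exact Nat.Coprime.pow_right 2 h2c
  exact hxn (hco.dvd_of_dvd_mul_left h4)

/-- a 3-cycle `y ≡ wz`, `z ≡ wx (mod n)` (`w = 3(n−1) ≡ −3`) with `x + y + z ≡ 0` forces `n ∣ 7x`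
(`0 ≡ x + y + z ≡ (1 + w² + w)x` and `1 + w + w² ≡ 1 − 3 + 9 = 7`) -/
lemma cycle_seven {n x y z : ℕ} (hn : 0 < n) (hs : n ∣ x + y + z)
    (hyz : y % n = 3 * (n - 1) * z % n) (hzx : z % n = 3 * (n - 1) * x % n) : n ∣ 7 * x := by
  obtain ⟨m, rfl⟩ : ∃ m, n = m + 1 := ⟨n - 1, by omega⟩
  rw [Nat.add_sub_cancel] at hyz hzx
  have hzx' : z ≡ 3 * m * x [MOD m + 1] := hzx
  have hyz' : y ≡ 3 * m * z [MOD m + 1] := hyz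
  have hy' : y ≡ 3 * m * (3 * m * x) [MOD m + 1] := hyz'.trans (hzx'.mul_left _)
  have hsum : x + y + z ≡ x + 3 * m * (3 * m * x) + 3 * m * x [MOD m + 1] :=
    ((Nat.ModEq.refl x).add hy').add hzx'
  have h0 : x + 3 * m * (3 * m * x) + 3 * m * x ≡ 0 [MOD m + 1] :=
    hsum.symm.trans (Nat.modEq_zero_iff_dvd.mpr hs)
  have h1 : (m + 1) ∣ x + 3 * m * (3 * m * x) + 3 * m * x := Nat.modEq_zero_iff_dvd.mp h0
  have h2 : (m + 1) ∣ 9 * m * (m + 1) * x + 7 * x := by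
    have e : 9 * m * (m + 1) * x + 7 * x = (x + 3 * m * (3 * m * x) + 3 * m * x) + (m + 1) * (6 * x) := by
      ring
    rw [e]
    exact Nat.dvd_add h1 (dvd_mul_right _ _)
  exact (Nat.dvd_add_right ⟨9 * m * x, by ring⟩).mp h2

/-- THEOREM KR6 at level `n` applied to `T̄′` and `wT̄′`: the permutation is a 3-cycle and `n ∣ 7x, 7y, 7z` -/
lemma seven_dvd (hKR : KR6') {n a b c x y z : ℕ} (hsq : Squarefree (3 * n)) (h2 : ¬ 2 ∣ n)
    (hs' : 3 * n ∣ x + y + z) (hx : ¬ 3 ∣ x) (hy : ¬ 3 ∣ y) (hz : ¬ 3 ∣ z)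
    (hH : SameType (3 * n) (3 * a, 3 * b, 3 * c) (x, y, z)) : n ∣ 7 * x ∧ n ∣ 7 * y ∧ n ∣ 7 * z := by
  have hn : 0 < n := pos_of_sq3 hsq
  have hsqn : Squarefree n := Squarefree.squarefree_of_dvd (dvd_mul_left n 3) hsq
  have h3n : ¬ 3 ∣ n := not_dvd_cofactor' Nat.prime_three hsq
  have hs1 : n ∣ x + y + z := dvd_of_level hs'
  obtain ⟨hxn, hyn, hzn⟩ := no_zero h3n hn hs' hx hy hz hH
  have h3u : Nat.Coprime 3 n := (Nat.Prime.coprime_iff_not_dvd Nat.prime_three).mpr h3n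
  have hw : Nat.Coprime (3 * (n - 1)) n :=
    Nat.Coprime.mul_left h3u ((Nat.coprime_self_sub_left hn).mpr (Nat.coprime_one_left n))
  have hsw : n ∣ 3 * (n - 1) * x + 3 * (n - 1) * y + 3 * (n - 1) * z := by
    rw [← mul_add, ← mul_add]; exact Dvd.dvd.mul_left hs1 _
  have hP := hKR n x y z (3 * (n - 1) * x) (3 * (n - 1) * y) (3 * (n - 1) * z) hsqn h2 h3n hs1 hsw hxn hyn hzn
    (unit_mul_not_dvd hw hxn) (unit_mul_not_dvd hw hyn) (unit_mul_not_dvd hw hzn) (stab h3n hn hs' hx hy hz hH)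
  have hsyzx : n ∣ y + z + x := by rwa [show y + z + x = x + y + z by ring]
  have hszxy : n ∣ z + x + y := by rwa [show z + x + y = x + y + z by ring]
  have hsxzy : n ∣ x + z + y := by rwa [show x + z + y = x + y + z by ring]
  have hsyxz : n ∣ y + x + z := by rwa [show y + x + z = x + y + z by ring]
  have hszyx : n ∣ z + y + x := by rwa [show z + y + x = x + y + z by ring]
  rcases hP with ⟨e, -, -⟩ | ⟨e, -, -⟩ | ⟨-, -, e⟩ | ⟨e₁, e₂, e₃⟩ | ⟨e₁, e₂, e₃⟩ | ⟨-, e, -⟩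
  · exact absurd e (no_fix hn h2 hxn)
  · exact absurd e (no_fix hn h2 hxn)
  · exact absurd e (no_fix hn h2 hzn)
  · -- the 3-cycle `x ≡ wy, y ≡ wz, z ≡ wx`
    exact ⟨cycle_seven hn hs1 e₂ e₃, cycle_seven hn hsyzx e₃ e₁, cycle_seven hn hszxy e₁ e₂⟩
  · -- the 3-cycle `x ≡ wz, y ≡ wx, z ≡ wy`
    exact ⟨cycle_seven hn hsxzy e₃ e₂, cycle_seven hn hsyxz e₁ e₃, cycle_seven hn hszyx e₂ e₁⟩
  · exact absurd e (no_fix hn h2 hyn)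

/-! ## (5) THEOREM Z3U -/

/-- **THEOREM Z3U, shape form, from THEOREM KR6.** -/
theorem z3uShape_of_kr6 (hKR : KR6') : Z3UShape := by
  intro n a b c x y z hsq h2 hs hs' ha hb hc hx hy hz hH
  have hn : 0 < n := pos_of_sq3 hsq
  have hsqn : Squarefree n := Squarefree.squarefree_of_dvd (dvd_mul_left n 3) hsq
  have h3n : ¬ 3 ∣ n := not_dvd_cofactor' Nat.prime_three hsq
  have hs1 : n ∣ x + y + z := dvd_of_level hs'
  have hsabc : n ∣ a + b + c := by
    rw [show 3 * a + 3 * b + 3 * c = 3 * (a + b + c) by ring] at hs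
    exact Nat.dvd_of_mul_dvd_mul_left (by norm_num) hs
  have han : ¬ n ∣ a := fun h => ha (Nat.mul_dvd_mul_left 3 h)
  have hbn : ¬ n ∣ b := fun h => hb (Nat.mul_dvd_mul_left 3 h)
  have hcn : ¬ n ∣ c := fun h => hc (Nat.mul_dvd_mul_left 3 h)
  obtain ⟨hxn, hyn, hzn⟩ := no_zero h3n hn hs' hx hy hz hH
  obtain ⟨h7x, h7y, h7z⟩ := seven_dvd hKR hsq h2 hs' hx hy hz hH
  have h7n : 7 ∣ n := by
    by_contra h7
    have hco : Nat.Coprime n 7 := ((Nat.Prime.coprime_iff_not_dvd (by norm_num : Nat.Prime 7)).mpr h7).symm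
    exact hxn (hco.dvd_of_dvd_mul_left h7x)
  obtain ⟨k, rfl⟩ := h7n
  rw [Nat.mul_div_cancel_left k (by norm_num : 0 < 7)]
  have hkx : k ∣ x := Nat.dvd_of_mul_dvd_mul_left (by norm_num : 0 < 7) h7x
  have hky : k ∣ y := Nat.dvd_of_mul_dvd_mul_left (by norm_num : 0 < 7) h7y
  have hkz : k ∣ z := Nat.dvd_of_mul_dvd_mul_left (by norm_num : 0 < 7) h7z
  -- THEOREM KR6 at level `n` for `T₀` and `T̄′`
  have hP := hKR (7 * k) a b c x y z hsqn h2 h3n hsabc hs1 han hbn hcn hxn hyn hzn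
    (sameType_down h3n hn hs' hx hy hz hH)
  have hk7 : k ∣ 7 * k := dvd_mul_left k 7
  have dx : k ∣ x % (7 * k) := (Nat.dvd_mod_iff hk7).mpr hkx
  have dy : k ∣ y % (7 * k) := (Nat.dvd_mod_iff hk7).mpr hky
  have dz : k ∣ z % (7 * k) := (Nat.dvd_mod_iff hk7).mpr hkz
  refine ⟨dvd_mul_right 7 k, ?_, ?_, ?_, hkx, hky, hkz⟩
  · have h : k ∣ a % (7 * k) := by
      rcases hP with ⟨e, -, -⟩ | ⟨e, -, -⟩ | ⟨e, -, -⟩ | ⟨e, -, -⟩ | ⟨e, -, -⟩ | ⟨e, -, -⟩ <;> rw [e] <;>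
        assumption
    exact (Nat.dvd_mod_iff hk7).mp h
  · have h : k ∣ b % (7 * k) := by
      rcases hP with ⟨-, e, -⟩ | ⟨-, e, -⟩ | ⟨-, e, -⟩ | ⟨-, e, -⟩ | ⟨-, e, -⟩ | ⟨-, e, -⟩ <;> rw [e] <;>
        assumption
    exact (Nat.dvd_mod_iff hk7).mp h
  · have h : k ∣ c % (7 * k) := by
      rcases hP with ⟨-, -, e⟩ | ⟨-, -, e⟩ | ⟨-, -, e⟩ | ⟨-, -, e⟩ | ⟨-, -, e⟩ | ⟨-, -, e⟩ <;> rw [e] <;>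
        assumption
    exact (Nat.dvd_mod_iff hk7).mp h

/-- **THEOREM Z3U from THEOREM KR6**: a jointly primitive (Z3, U)-at-3 coincidence at a squarefree level `3n`
(`n` odd) has `3n = 21`. -/
theorem z3u_of_kr6 (hKR : KR6') : Z3U := by
  intro n a b c x y z hsq h2 hs hs' ha hb hc hx hy hz hjp hH
  obtain ⟨h7n, ka, kb, kc, kx, ky, kz⟩ := z3uShape_of_kr6 hKR n a b c x y z hsq h2 hs hs' ha hb hc hx hy hz hH
  obtain ⟨k, rfl⟩ := h7n
  rw [Nat.mul_div_cancel_left k (by norm_num : 0 < 7)] at ka kb kc kx ky kz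
  suffices hk : k = 1 by subst hk; norm_num
  by_contra hk
  have hq : (Nat.minFac k).Prime := Nat.minFac_prime hk
  have hqk : Nat.minFac k ∣ k := Nat.minFac_dvd k
  exact hjp _ hq (dvd_mul_of_dvd_right (dvd_mul_of_dvd_right hqk 7) 3)
    (dvd_mul_of_dvd_right (hqk.trans ka) 3) (dvd_mul_of_dvd_right (hqk.trans kb) 3)
    (dvd_mul_of_dvd_right (hqk.trans kc) 3) (hqk.trans kx) (hqk.trans ky) (hqk.trans kz)

/-! ## Kernel sanity checks -/

/-- the hypotheses of THEOREM Z3U are realised at `m = 21`: `3·(1, 2, 4) ∼ (1, 4, 16)` (F21a; jointly primitive,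
disjoint) -/
example : SameType (3 * 7) (3 * 1, 3 * 2, 3 * 4) (1, 4, 16) := sameType_of_fin (by norm_num) (by decide)

/-- … and the shape form is sharp: `5` times that pair is a (non-primitive) (Z3, U)-at-3 coincidence of level
`105 = 3·35`, `35 / 7 = 5` dividing all six of `a, b, c, x, y, z` -/
example : SameType (3 * 35) (3 * 5, 3 * 10, 3 * 20) (5, 20, 80) := sameType_of_fin (by norm_num) (by decide)

/-- the unit `w = 3(n − 1) ≡ −3` at `n = 7` is `18 ≡ 4`, of order `3`, permuting `T̄′ = (1, 4, 16) ≡ (1, 4, 2)`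
cyclically: `4·(1, 4, 2) ≡ (4, 2, 1) (mod 7)`; and `1 + w + w² = 343 = 7³` -/
example : Perm3 (1 % 7) (4 % 7) (16 % 7) (3 * (7 - 1) * 1 % 7) (3 * (7 - 1) * 4 % 7) (3 * (7 - 1) * 16 % 7) := by
  unfold Perm3; decide

end HodgeFermat.KRFree.TheoremZ3U
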